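import Mathlib.Analysis.SpecialFunctions.Integrability.Basic
import Mathlib.Analysis.Complex.UpperHalfPlane.MoebiusAction
import Mathlib.Analysis.Complex.ReImTopology
import Literature.Probability.RandomPlanarGeometry.CritPercCardyFunction
import HarnessLib

/-!
# Carleson's form of Cardy's formula: reduction to three classical analytic facts

This file works towards the named fact `Literature.Probability.RandomPlanarGeometry.cardyFunction_crossRatio_eq_of_equilateral`
of `Literature.Probability.RandomPlanarGeometry.CritPercCardyFunction` (**crit-perc.S17**,
Carleson's observation, Bollobás–Riordan (2006), Ch. 7, eq. (3): for the equilateral triangle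
`abc` with the fourth marked point `d ∈ (ca)`, Cardy's hypergeometric crossing probability
`F(η)` of the cross-ratio `η` of any uniformizing datum equals `|d - c| / |a - c|`).

The printed argument ("Carleson showed …", Bollobás–Riordan p. 178; Werner (2007), Conj. 2.1;
Smirnov (2001), Cor. 3) is the Schwarz–Christoffel computation, which we decompose as follows.

1. **`Aut(ℍ) = PSL(2, ℝ)`** (Berenstein–Gay (1991), Exercise 2.3.15 (b)): every conformal
   automorphism of `ℍₒ` is a real Möbius map — vendored as the named fact
   `Literature.Probability.RandomPlanarGeometry.conformalEquiv_upperHalfPlaneSet_eq_specialLinearGroup` (stated with Mathlib's action of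
   `SL(2, ℝ)` on `UpperHalfPlane`).
2. **Schwarz–Christoffel** (Berenstein–Gay (1991), §2.8, discussion after Prop. 2.8.14 and
   Example (2) with `α₁ = α₂ = 1/3`, `a₁ = 0`, `a₂ = 1`): the map
   `Ψ = S / B(1/3,1/3)`, `S(w) = ∫_0^w t^{-2/3}(1-t)^{-2/3} dt` (`Literature.Probability.RandomPlanarGeometry.schwarzTriangleMap`), is a
   conformal equivalence of `ℍₒ` onto the open equilateral triangle with vertices
   `Ψ(0) = 0`, `Ψ(1) = 1`, `Ψ(∞) = ζ = e^{iπ/3}` (`Literature.Probability.RandomPlanarGeometry.refEquilateralTriangle`), a homeomorphism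
   up to the boundary, with `Ψ(u) = B(u; 1/3, 1/3) / B(1/3, 1/3)` on `[0, 1]` and the two
   half-lines `u < 0`, `u > 1` going onto the two other (open) sides — vendored as the named fact
   `Literature.Probability.RandomPlanarGeometry.schwarzTriangleMap_isUniformizing`, phrased with `ConformalEquiv.HasBoundaryValue(AtInfty)`.
3. **Cardy's function is the regularised incomplete beta function**
   `F(η) = B(η; 1/3, 1/3) / B(1/3, 1/3)` on `[0, 1]` (Cardy (1992), eq. (8): `F' ∝ (η(1-η))^{-2/3}`;
   Beals–Wong (2016), §10.7, Exercise 4: `B_x(a,b) = (x^a/a) ₂F₁(a, 1-b; a+1; x)` (Gauss);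
   Andrews–Askey–Roy (1999), Thm 1.1.4: `B(a,b) = Γ(a)Γ(b)/Γ(a+b)`) — vendored as the named fact
   `Literature.Probability.RandomPlanarGeometry.cardyFunction_eq_incBeta13_div`.
4. **Assembly** (`Literature.Probability.RandomPlanarGeometry.cardyFunction_crossRatio_eq_of_equilateral_of_facts`, PROVED from
   1–3): transport the given uniformizing map `φ : ℍₒ → abc` to `Ψ` by the complex-affine map `L`
   with `L(1), L(ζ), L(0) = a, b, c` (or `= c, b, a` for the other orientation of `abc`,
   `Literature.Probability.RandomPlanarGeometry.equilateral_apex_cases`); `(LΨ)⁻¹ ∘ φ ∈ Aut(ℍₒ)` is a real Möbius map `g` (fact 1);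
   comparing boundary values (`Literature.Probability.RandomPlanarGeometry.hasBoundaryValue_of_moebius`, `…_pole`, uniqueness of limits
   along the non-trivial filter `𝓝[ℍₒ] x`) forces `g(x₀) = 1`, `g(x₁) = ∞`, `g(x₂) = 0`,
   `g(x₃) = e ∈ (0, 1)` with `d = L(Ψ(e))` (fact 2 and the strict monotonicity of the incomplete
   beta integral, `Literature.Probability.RandomPlanarGeometry.strictMonoOn_incBeta13`, PROVED); Möbius invariance of the cross-ratio gives
   `η = e` (resp. `1 - e`), and fact 3 (with the symmetry `B(1-u) = B(1) - B(u)`,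
   `Literature.Probability.RandomPlanarGeometry.incBeta13_one_sub`, PROVED) gives `F(η) = |d - c| / |a - c|`.

Everything except the three named facts 1–3 is proved. Discharging them is left to their own
files: (1) via the Schwarz lemma (Mathlib `Complex.norm_le_norm_of_mapsTo_ball_self`) and the
Cayley transform; (2) is a chapter of complex analysis (argument principle / Darboux–Picard,
boundary behaviour of Schwarz–Christoffel integrals); (3) is termwise integration of the binomial
series plus Euler's beta integral (Mathlib `Complex.betaIntegral`, `Complex.Gamma_mul_Gamma_eq_betaIntegral`).

## Design notes

* The incomplete beta integral is the real interval integral `Literature.incBeta13 u = ∫_0^u (s(1-s))^{-2/3} ds`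
  (`intervalIntegral`, junk outside `[0, 1]` irrelevant); its integrability, positivity, strict
  monotonicity and the symmetry under `u ↦ 1 - u` are proved here from
  `intervalIntegral.intervalIntegrable_rpow'`.
* `Literature.Probability.RandomPlanarGeometry.schwarzTriangleMap` is defined on all of `ℂ` by the segment parametrisation
  `S(w) = w ∫_0^1 (sw)^{-2/3} (1 - sw)^{-2/3} ds` with Mathlib's principal-branch `cpow`; for
  `w ∈ ℍₒ` one has `sw ∈ ℍₒ` and `1 - sw ∈ -ℍₒ`, away from both branch cuts, so this IS the
  Schwarz–Christoffel integral with the branch positive on `(0, 1)`; only its restriction to `ℍₒ`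
  enters the named fact (`EqOn … upperHalfPlaneSet`), boundary values being phrased as limits.
* Facts 1 and 2 are general complex analysis (they also underlie
  `Literature.Probability.RandomPlanarGeometry.MarkedDomain.IsChordalUniformizing.exists_eq_trans_smul` and
  `Literature.Probability.RandomPlanarGeometry.ConformalRectangle.crossRatio_eq_of_isUniformizing`); they live here for now and may be
  moved to a dedicated module without change of statement.

## References

* B. Bollobás, O. Riordan, *Percolation*, CUP (2006), Ch. 7 §1, eqs. (2), (3) (Carleson's form).
* W. Werner, *Lectures on two-dimensional critical percolation*, IAS/Park City (2007),
  arXiv:0710.0856, Conjecture 2.1 (Cardy's formula, Carleson's version).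
* S. Smirnov, *Critical percolation in the plane*, C. R. Acad. Sci. Paris 333 (2001), Cor. 3.
* C. A. Berenstein, R. Gay, *Complex Variables*, GTM 125, Springer (1991): Exercise 2.3.15 (b)
  (`Aut(H) = SL(2,ℝ)/{±I}`); §2.8, Prop. 2.8.14 and the Schwarz–Christoffel discussion following
  it, Example (2) (equilateral triangle, `a₁ = 0`, `a₂ = 1`, third vertex the image of `∞`).
* J. Cardy, *Critical percolation in finite geometries*, J. Phys. A 25 (1992) L201–L206, eq. (8).
* R. Beals, R. Wong, *Special Functions and Orthogonal Polynomials*, CUP (2016), §10.7 Exercise 4.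
* G. E. Andrews, R. Askey, R. Roy, *Special Functions*, CUP (1999), Def. 1.1.3, Thm 1.1.4.
-/

open Set Filter Topology Complex MeasureTheory
open UpperHalfPlane (upperHalfPlaneSet isOpen_upperHalfPlaneSet)

noncomputable section

namespace Literature.Probability.RandomPlanarGeometry

/-! ### The incomplete beta integral `B(u; 1/3, 1/3)` -/

/-- The kernel `(s(1-s))^{-2/3} = s^{1/3 - 1} (1-s)^{1/3 - 1}` of the incomplete beta integral
`B(u; 1/3, 1/3)` (Andrews–Askey–Roy 1999, Def. 1.1.3, with `x = y = 1/3`); as `Real.rpow`, junk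
(but irrelevant) outside `[0, 1]`. [cite: AndrewsAskeyRoy1999, Def. 1.1.3] -/
def betaKernel13 (s : ℝ) : ℝ := (s * (1 - s)) ^ (-(2 / 3 : ℝ))

/-- The incomplete beta integral `B(u; 1/3, 1/3) = ∫_0^u (s(1-s))^{-2/3} ds` (Beals–Wong 2016,
§10.7 Exercise 4, `B_x(a,b) = ∫_0^x t^{a-1}(1-t)^{b-1} dt` with `a = b = 1/3`), as a real interval
integral; used for `u ∈ [0, 1]`, where `B(1; 1/3, 1/3) = B(1/3, 1/3) = Γ(1/3)²/Γ(2/3)`. It is also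
the boundary parametrisation of the Schwarz–Christoffel map of the equilateral triangle on the
side `[0, 1]`. [cite: BealsWong2016, §10.7 Exercise 4] -/
def incBeta13 (u : ℝ) : ℝ := ∫ s in (0 : ℝ)..u, betaKernel13 s

/-- The kernel `(s(1-s))^{-2/3}` is positive on `(0, 1)`. [folklore] -/
theorem betaKernel13_pos {s : ℝ} (hs : s ∈ Ioo (0 : ℝ) 1) : 0 < betaKernel13 s :=
  Real.rpow_pos_of_pos (mul_pos hs.1 (by linarith [hs.2])) _

/-- The kernel `(s(1-s))^{-2/3}` is symmetric under `s ↦ 1 - s`. [folklore] -/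
theorem betaKernel13_one_sub (s : ℝ) : betaKernel13 (1 - s) = betaKernel13 s := by
  simp only [betaKernel13, sub_sub_cancel, mul_comm]

/-- Integrability of `(s(1-s))^{-2/3}` on `[0, 1/2]`: there the kernel is `s^{-2/3}` times a
continuous function (Andrews–Askey–Roy 1999, Def. 1.1.3: the beta integral converges for positive
parameters). [cite: AndrewsAskeyRoy1999, Def. 1.1.3] -/
theorem intervalIntegrable_betaKernel13_half : IntervalIntegrable betaKernel13 volume 0 (1 / 2) := by
  have h1 : IntervalIntegrable (fun s : ℝ => s ^ (-(2 / 3 : ℝ))) volume 0 (1 / 2) :=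
    intervalIntegral.intervalIntegrable_rpow' (by norm_num)
  have h2 : ContinuousOn (fun s : ℝ => (1 - s) ^ (-(2 / 3 : ℝ))) (uIcc 0 (1 / 2)) := by
    refine ContinuousOn.rpow_const (continuousOn_const.sub continuousOn_id) fun s hs => Or.inl ?_
    rw [uIcc_of_le (by norm_num : (0 : ℝ) ≤ 1 / 2)] at hs
    have := hs.2
    intro h
    linarith
  refine (h1.mul_continuousOn h2).congr_uIoo fun s hs => ?_
  rw [uIoo_of_le (by norm_num : (0 : ℝ) ≤ 1 / 2)] at hs
  simp only [betaKernel13]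
  rw [Real.mul_rpow hs.1.le (by linarith [hs.2])]

/-- The kernel `(s(1-s))^{-2/3}` is integrable on `[0, 1]` (the beta integral `B(1/3, 1/3)`
converges; Andrews–Askey–Roy 1999, Def. 1.1.3). [cite: AndrewsAskeyRoy1999, Def. 1.1.3] -/
theorem intervalIntegrable_betaKernel13 : IntervalIntegrable betaKernel13 volume 0 1 := by
  refine intervalIntegrable_betaKernel13_half.trans ?_
  -- on `[1/2, 1]` use the symmetry `s ↦ 1 - s`
  have h := intervalIntegrable_betaKernel13_half.comp_sub_left 1
  simp only [betaKernel13_one_sub] at h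
  norm_num at h
  exact h.symm

/-- The kernel `(s(1-s))^{-2/3}` is integrable on every subinterval of `[0, 1]`. [folklore] -/
theorem intervalIntegrable_betaKernel13_of_mem {a b : ℝ} (ha : a ∈ Icc (0 : ℝ) 1)
    (hb : b ∈ Icc (0 : ℝ) 1) : IntervalIntegrable betaKernel13 volume a b :=
  intervalIntegrable_betaKernel13.mono_set (by
    rw [uIcc_of_le zero_le_one]
    exact uIcc_subset_Icc ha hb)

/-- `B(0; 1/3, 1/3) = 0`. [folklore] -/
theorem incBeta13_zero : incBeta13 0 = 0 := by simp [incBeta13]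

/-- Strict monotonicity of `u ↦ B(u; 1/3, 1/3)` on `[0, 1]` (the integrand is positive and
integrable). [folklore] -/
theorem strictMonoOn_incBeta13 : StrictMonoOn incBeta13 (Icc 0 1) := by
  intro a ha b hb hab
  have hint : incBeta13 b = incBeta13 a + ∫ s in a..b, betaKernel13 s := by
    unfold incBeta13
    rw [intervalIntegral.integral_add_adjacent_intervals
      (intervalIntegrable_betaKernel13_of_mem ⟨le_rfl, zero_le_one⟩ ha)
      (intervalIntegrable_betaKernel13_of_mem ha hb)]
  have hpos : 0 < ∫ s in a..b, betaKernel13 s :=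
    intervalIntegral.intervalIntegral_pos_of_pos_on (intervalIntegrable_betaKernel13_of_mem ha hb)
      (fun s hs => betaKernel13_pos ⟨ha.1.trans_lt hs.1, hs.2.trans_le hb.2⟩) hab
  linarith

/-- `B(u; 1/3, 1/3) > 0` for `u ∈ (0, 1]`. [folklore] -/
theorem incBeta13_pos {u : ℝ} (hu : u ∈ Ioc (0 : ℝ) 1) : 0 < incBeta13 u := by
  have := strictMonoOn_incBeta13 (by simp) ⟨hu.1.le, hu.2⟩ hu.1
  rwa [incBeta13_zero] at this

/-- The complete beta integral `B(1/3, 1/3) = B(1; 1/3, 1/3)` is positive. [folklore] -/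
theorem incBeta13_one_pos : 0 < incBeta13 1 := incBeta13_pos ⟨one_pos, le_rfl⟩

/-- `B(u; 1/3, 1/3) ≥ 0` for `u ∈ [0, 1]`. [folklore] -/
theorem incBeta13_nonneg {u : ℝ} (hu : u ∈ Icc (0 : ℝ) 1) : 0 ≤ incBeta13 u := by
  have := strictMonoOn_incBeta13.monotoneOn (by simp) hu hu.1
  rwa [incBeta13_zero] at this

/-- The symmetry `B(1-u; 1/3, 1/3) = B(1/3, 1/3) - B(u; 1/3, 1/3)` of the incomplete beta integral
with equal parameters (substitution `s ↦ 1 - s`; this is the source of `F(1-η) = 1 - F(η)`,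
Bollobás–Riordan 2006, Ch. 7, eq. (4)). [cite: BollobasRiordan2006, Ch. 7 eq. (4)] -/
theorem incBeta13_one_sub {u : ℝ} (hu : u ∈ Icc (0 : ℝ) 1) :
    incBeta13 (1 - u) = incBeta13 1 - incBeta13 u := by
  unfold incBeta13
  have h1 : (∫ s in (0 : ℝ)..(1 - u), betaKernel13 s) = ∫ s in u..1, betaKernel13 s := by
    have := intervalIntegral.integral_comp_sub_left (a := u) (b := 1) betaKernel13 1
    simp only [betaKernel13_one_sub, sub_self] at this
    rw [← this]
  rw [h1, ← intervalIntegral.integral_add_adjacent_intervals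
      (intervalIntegrable_betaKernel13_of_mem ⟨le_rfl, zero_le_one⟩ hu)
      (intervalIntegrable_betaKernel13_of_mem hu ⟨zero_le_one, le_rfl⟩)]
  ring

/-- `u ↦ B(u; 1/3, 1/3)` is injective on `[0, 1]`. [folklore] -/
theorem injOn_incBeta13 : InjOn incBeta13 (Icc 0 1) := strictMonoOn_incBeta13.injOn


/-! ### The reference equilateral triangle -/

/-- The apex `ζ = 1/2 + i√3/2 = e^{iπ/3}` of the reference equilateral triangle `(0, 1, ζ)`, the
image of `∞` under the Schwarz–Christoffel map with `a₁ = 0`, `a₂ = 1` (Berenstein–Gay 1991, §2.8,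
Example (2)). [cite: BerensteinGay1991, §2.8 Example (2)] -/
def equilateralApex : ℂ := ⟨1 / 2, Real.sqrt 3 / 2⟩

/-- Real part of the apex `ζ = e^{iπ/3}`. [folklore] -/
@[simp] theorem equilateralApex_re : equilateralApex.re = 1 / 2 := rfl
/-- Imaginary part of the apex `ζ = e^{iπ/3}`. [folklore] -/
@[simp] theorem equilateralApex_im : equilateralApex.im = Real.sqrt 3 / 2 := rfl

/-- The apex `ζ` lies in the upper half-plane. [folklore] -/
theorem equilateralApex_im_pos : 0 < equilateralApex.im := by
  rw [equilateralApex_im]; positivity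

/-- `ζ ≠ 0`. [folklore] -/
theorem equilateralApex_ne_zero : equilateralApex ≠ 0 := fun h => by
  have := equilateralApex_im_pos; rw [h] at this; simp at this

/-- `ζ ≠ 1`. [folklore] -/
theorem equilateralApex_ne_one : equilateralApex ≠ 1 := fun h => by
  have := equilateralApex_im_pos; rw [h] at this; simp at this

/-- `ζ` is not real. [folklore] -/
theorem equilateralApex_ne_ofReal (t : ℝ) : equilateralApex ≠ (t : ℂ) := fun h => by
  have := equilateralApex_im_pos; rw [h] at this; simp at this

/-- The open reference equilateral triangle with vertices `1`, `ζ = e^{iπ/3}`, `0` (listed in the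
order matching the marked points `a, b, c` of `cardyFunction_crossRatio_eq_of_equilateral`): the
interior of their convex hull. [cite: BerensteinGay1991, §2.8 Example (2)] -/
def refEquilateralTriangle : Set ℂ := interior (convexHull ℝ {(1 : ℂ), equilateralApex, 0})

/-! ### Complex-affine maps -/

/-- The complex-affine map `z ↦ α z + β` (`α ≠ 0`) as a conformal equivalence from any `U` onto its
image. [folklore] -/
def ConformalEquiv.affine (α β : ℂ) (hα : α ≠ 0) (U : Set ℂ) :
    ConformalEquiv U ((fun z ↦ α * z + β) '' U) where
  toFun z := α * z + β
  invFun w := α⁻¹ * (w - β)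
  source := U
  target := (fun z ↦ α * z + β) '' U
  map_source' z hz := mem_image_of_mem _ hz
  map_target' := by
    rintro _ ⟨z, hz, rfl⟩
    have : α⁻¹ * (α * z + β - β) = z := by field_simp; ring
    simpa only [this] using hz
  left_inv' z _ := by field_simp; ring
  right_inv' w _ := by field_simp; ring
  source_eq := rfl
  target_eq := rfl
  differentiableOn := by fun_prop
  differentiableOn_symm := by fun_prop

/-- `ConformalEquiv.affine α β` acts as `z ↦ α z + β`. [folklore] -/
@[simp] theorem ConformalEquiv.affine_apply (α β : ℂ) (hα : α ≠ 0) (U : Set ℂ) (z : ℂ) :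
    ConformalEquiv.affine α β hα U z = α * z + β := rfl

/-- The image of the reference triangle under `z ↦ α z + β` (`α ≠ 0`, a homeomorphism and a real
affine map) is the open triangle with vertices `α + β`, `α ζ + β`, `β`. [folklore] -/
theorem image_affine_refEquilateralTriangle (α β : ℂ) (hα : α ≠ 0) :
    (fun z ↦ α * z + β) '' refEquilateralTriangle = interior (convexHull ℝ {α + β, α * equilateralApex + β, β}) := by
  let e : ℂ ≃ₜ ℂ := (Homeomorph.mulLeft₀ α hα).trans (Homeomorph.addRight β)
  have he : ⇑e = fun z ↦ α * z + β := rfl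
  let f : ℂ →ᵃ[ℝ] ℂ := (LinearMap.mulLeft ℝ α).toAffineMap + AffineMap.const ℝ ℂ β
  have hf : ⇑f = fun z ↦ α * z + β := by
    ext z; simp [f]
  rw [refEquilateralTriangle, ← he, e.image_interior, he, ← hf, AffineMap.image_convexHull, hf]
  simp [image_insert_eq]

/-! ### Boundary filters of the upper half-plane -/

/-- Real points are limit points of the open upper half-plane: the filter `𝓝[ℍₒ] x` is
non-trivial for real `x` (`closure ℍₒ = {im ≥ 0}`, Mathlib `Complex.closure_setOf_lt_im`). [folklore] -/
theorem neBot_nhdsWithin_upperHalfPlaneSet (x : ℝ) : (𝓝[upperHalfPlaneSet] (x : ℂ)).NeBot := by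
  rw [← mem_closure_iff_nhdsWithin_neBot, upperHalfPlaneSet, Complex.closure_setOf_lt_im]
  simp

/-- Boundary values of a map on `ℍₒ` at a real point are unique. [folklore] -/
theorem ConformalEquiv.HasBoundaryValue.unique {V : Set ℂ} {φ : ConformalEquiv upperHalfPlaneSet V}
    {x : ℝ} {p q : ℂ} (hp : φ.HasBoundaryValue x p) (hq : φ.HasBoundaryValue x q) : p = q :=
  haveI := neBot_nhdsWithin_upperHalfPlaneSet x
  tendsto_nhds_unique hp hq

/-- A complex-valued function whose norm tends to `+∞` tends to the point at infinity
(filter `cocompact ℂ`; Mathlib `Metric.cobounded_eq_cocompact`). [folklore] -/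
theorem tendsto_cocompact_complex_of_norm_atTop {α : Type*} {l : Filter α} {f : α → ℂ}
    (h : Tendsto (fun a ↦ ‖f a‖) l atTop) : Tendsto f l (cocompact ℂ) := by
  rw [← Metric.cobounded_eq_cocompact]
  exact tendsto_norm_atTop_iff_cobounded.mp h


/-! ### Named facts -/

/-- **Automorphisms of the upper half-plane** (Berenstein–Gay 1991, Exercise 2.3.15 (b); Ahlfors
1979, Ch. 4). Every biholomorphism of `H = ℍₒ` onto itself is a Möbius transformation
`w ↦ (aw + b)/(cw + d)` with `a, b, c, d ∈ ℝ`, `ad - bc = 1`; this identifies `Aut(H)` with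
`SL(2, ℝ)/{±I}`. Stated for `Literature.ConformalEquiv ℍₒ ℍₒ` with Mathlib's action of `SL(2, ℝ)` on
`UpperHalfPlane` (`UpperHalfPlane.coe_specialLinearGroup_apply`). Proof: Cayley transform to the
disc and the Schwarz lemma. [cite: BerensteinGay1991, Exercise 2.3.15 (b)] -/
def conformalEquiv_upperHalfPlaneSet_eq_specialLinearGroup : Prop :=
  ∀ M : ConformalEquiv upperHalfPlaneSet upperHalfPlaneSet,
    ∃ g : Matrix.SpecialLinearGroup (Fin 2) ℝ, ∀ z : UpperHalfPlane, M (z : ℂ) = ((g • z :) : ℂ)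

/-- The **Schwarz–Christoffel integral of the equilateral triangle** (Berenstein–Gay 1991, §2.8,
Example (2) with `α₁ = α₂ = 1/3`, `a₁ = 0`, `a₂ = 1`):
`S(w) = ∫_0^w t^{-2/3} (1 - t)^{-2/3} dt = w ∫_0^1 (sw)^{-2/3} (1 - sw)^{-2/3} ds`, the integral
being taken along the segment `[0, w]` with Mathlib's principal-branch `cpow`. For `w ∈ ℍₒ` and
`s ∈ (0, 1]` one has `sw ∈ ℍₒ` and `1 - sw ∈ -ℍₒ`, away from both branch cuts, so on `ℍₒ` this is
the holomorphic branch of the Schwarz–Christoffel integral that is positive on `(0, 1)`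
(where `S(u) = B(u; 1/3, 1/3) = incBeta13 u`); values off `ℍₒ ∪ [0, 1]` are junk and unused. We
use the factor `(1 - t)^{-2/3}` (positive on `(0,1)`) instead of Berenstein–Gay's `(t - 1)^{-2/3}`;
the two differ by a unimodular constant. [cite: BerensteinGay1991, §2.8 Example (2)] -/
def schwarzTriangleMap (w : ℂ) : ℂ :=
  w * ∫ s in (0 : ℝ)..1, ((s : ℂ) * w) ^ (-(2 / 3 : ℂ)) * (1 - (s : ℂ) * w) ^ (-(2 / 3 : ℂ))

/-- **Schwarz–Christoffel uniformization of the equilateral triangle** (Berenstein–Gay 1991,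
§2.8: Prop. 2.8.14 and the discussion of Schwarz–Christoffel transformations following it — `f`
is a homeomorphism of `H̄ ∪ {∞}` onto the closed polygon, biholomorphic from `H` onto its interior,
mapping `[a_{k-1}, a_k]` onto the side `[w_{k-1}, w_k]` and `∞` to the remaining vertex — applied
to Example (2), the equilateral triangle with `a₁ = 0`, `a₂ = 1`). Normalised by the side length
`B(1/3, 1/3) = incBeta13 1`, the map `Ψ = S / B(1/3,1/3)` (`S = schwarzTriangleMap`) is a conformal
equivalence of `ℍₒ` onto the open triangle with vertices `1, ζ, 0` (`refEquilateralTriangle`,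
`ζ = e^{iπ/3}`; the triangle lies to the left of the positively traversed side `0 → 1`), whose
boundary values are: `Ψ(u) = B(u; 1/3, 1/3)/B(1/3, 1/3) ∈ [0, 1]` at `u ∈ [0, 1]`; a point of the
open side `(ζ, 0)` at `u < 0`; a point of the open side `(1, ζ)` at `u > 1`; and `ζ` at `∞`.
Boundary values are phrased as limits along `𝓝[ℍₒ] u` (`ConformalEquiv.HasBoundaryValue`) and
`cocompact ℂ ⊓ 𝓟 ℍₒ` (`HasBoundaryValueAtInfty`). [cite: BerensteinGay1991, §2.8 Prop. 2.8.14 and Example (2)] -/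
def schwarzTriangleMap_isUniformizing : Prop :=
  ∃ Ψ : ConformalEquiv upperHalfPlaneSet refEquilateralTriangle,
    EqOn Ψ (fun w ↦ schwarzTriangleMap w / incBeta13 1) upperHalfPlaneSet ∧
    (∀ u : ℝ, u ∈ Icc (0 : ℝ) 1 → Ψ.HasBoundaryValue u ((incBeta13 u / incBeta13 1 : ℝ) : ℂ)) ∧
    (∀ u : ℝ, u < 0 → ∃ p ∈ openSegment ℝ equilateralApex (0 : ℂ), Ψ.HasBoundaryValue u p) ∧
    (∀ u : ℝ, 1 < u → ∃ p ∈ openSegment ℝ (1 : ℂ) equilateralApex, Ψ.HasBoundaryValue u p) ∧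
    Ψ.HasBoundaryValueAtInfty equilateralApex

/-- **Cardy's function is the regularised incomplete beta function**:
`F(η) = B(η; 1/3, 1/3) / B(1/3, 1/3)` for `η ∈ [0, 1]`. Printed sources: Cardy 1992, eq. (8)
(`dF/dη ∝ (η(1-η))^{-2/3}`) with eq. (11) (`F = (3Γ(2/3)/Γ(1/3)²) η^{1/3} ₂F₁(1/3,2/3;4/3;η)`);
equivalently Gauss's identity `B_x(a, b) = (x^a/a) ₂F₁(a, 1-b; a+1; x)` (Beals–Wong 2016, §10.7
Exercise 4) with `a = b = 1/3`, and Euler's `B(1/3,1/3) = Γ(1/3)²/Γ(2/3)` (Andrews–Askey–Roy 1999,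
Thm 1.1.4). At `η = 1` Mathlib's `₂F₁` is the sum of the (absolutely convergent) Gauss series, so the
identity there is Gauss's summation theorem; in particular this fact implies
`Literature.Probability.RandomPlanarGeometry.cardyFunction_one`. [cite: BealsWong2016, §10.7 Exercise 4] -/
def cardyFunction_eq_incBeta13_div : Prop :=
  ∀ η ∈ Icc (0 : ℝ) 1, cardyFunction η = incBeta13 η / incBeta13 1

/-! ### Boundary values transported along a Möbius map -/

section Transfer

variable {V : Set ℂ} (Φ φ : ConformalEquiv upperHalfPlaneSet V)
  (g : Matrix.SpecialLinearGroup (Fin 2) ℝ)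

/-- The real Möbius map `z ↦ (g₀₀ z + g₀₁)/(g₁₀ z + g₁₁)` of `g ∈ SL(2, ℝ)` as a function
`ℂ → ℂ` (junk value at the pole by `x / 0 = 0`); on `ℍ` it is Mathlib's `g • z`
(Berenstein–Gay 1991, Exercise 2.3.15). [cite: BerensteinGay1991, Exercise 2.3.15] -/
def moebiusFun (g : Matrix.SpecialLinearGroup (Fin 2) ℝ) (z : ℂ) : ℂ :=
  ((g 0 0 : ℝ) * z + (g 0 1 : ℝ)) / ((g 1 0 : ℝ) * z + (g 1 1 : ℝ))

/-- Mathlib's action of `SL(2, ℝ)` on `ℍ` is given by `moebiusFun`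
(`UpperHalfPlane.coe_specialLinearGroup_apply`). [folklore] -/
theorem coe_smul_eq_moebiusFun (z : UpperHalfPlane) : ((g • z :) : ℂ) = moebiusFun g z := by
  rw [UpperHalfPlane.coe_specialLinearGroup_apply]; rfl

/-- A real Möbius map of determinant `1` preserves the open upper half-plane
(Berenstein–Gay 1991, Exercise 2.3.15). [cite: BerensteinGay1991, Exercise 2.3.15] -/
theorem moebiusFun_mem {z : ℂ} (hz : z ∈ upperHalfPlaneSet) : moebiusFun g z ∈ upperHalfPlaneSet := by
  rw [← coe_smul_eq_moebiusFun g ⟨z, hz⟩]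
  exact (g • (⟨z, hz⟩ : UpperHalfPlane)).im_pos

/-- The determinant condition `ad - bc = 1` of `g ∈ SL(2, ℝ)` in terms of entries. [folklore] -/
theorem sl2_det_entries : g 0 0 * g 1 1 - g 0 1 * g 1 0 = 1 := by
  have := g.det_coe; rwa [Matrix.det_fin_two] at this

variable {Φ φ g}

/-- Transfer of a boundary value along a Möbius map at a regular point: if `φ = Φ ∘ g` on `ℍₒ`,
`g₁₀ x + g₁₁ ≠ 0` and `Φ → p` at the real point `g x`, then `φ → p` at `x`. [folklore] -/
theorem hasBoundaryValue_of_moebius (hφ : ∀ z ∈ upperHalfPlaneSet, φ z = Φ (moebiusFun g z))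
    {x : ℝ} (hx : g 1 0 * x + g 1 1 ≠ 0) {p : ℂ}
    (hΦ : Φ.HasBoundaryValue ((g 0 0 * x + g 0 1) / (g 1 0 * x + g 1 1) : ℝ) p) :
    φ.HasBoundaryValue x p := by
  set m : ℝ := (g 0 0 * x + g 0 1) / (g 1 0 * x + g 1 1)
  have hcont : ContinuousAt (moebiusFun g) x := by
    unfold moebiusFun
    refine ContinuousAt.div (by fun_prop) (by fun_prop) ?_
    exact_mod_cast hx
  have hmx : moebiusFun g x = (m : ℂ) := by
    simp only [moebiusFun, m]; push_cast; rfl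
  have h1 : Tendsto (moebiusFun g) (𝓝[upperHalfPlaneSet] (x : ℂ)) (𝓝[upperHalfPlaneSet] (m : ℂ)) := by
    refine tendsto_nhdsWithin_of_tendsto_nhds_of_eventually_within _ ?_ ?_
    · rw [← hmx]; exact hcont.tendsto.mono_left nhdsWithin_le_nhds
    · exact eventually_mem_nhdsWithin.mono fun z hz => moebiusFun_mem g hz
  have h2 : Tendsto (Φ ∘ moebiusFun g) (𝓝[upperHalfPlaneSet] (x : ℂ)) (𝓝 p) := hΦ.comp h1
  refine h2.congr' ?_
  exact eventually_mem_nhdsWithin.mono fun z hz => (hφ z hz).symm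

/-- Transfer of a boundary value along a Möbius map at its pole: if `φ = Φ ∘ g` on `ℍₒ`,
`g₁₀ x + g₁₁ = 0` and `Φ → p` at `∞`, then `φ → p` at `x`. [folklore] -/
theorem hasBoundaryValue_of_moebius_pole (hφ : ∀ z ∈ upperHalfPlaneSet, φ z = Φ (moebiusFun g z))
    {x : ℝ} (hx : g 1 0 * x + g 1 1 = 0) {p : ℂ} (hΦ : Φ.HasBoundaryValueAtInfty p) :
    φ.HasBoundaryValue x p := by
  have hdet := sl2_det_entries g
  have hc : g 1 0 ≠ 0 := by
    intro h0
    have h1 : g 1 1 = 0 := by simpa [h0] using hx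
    rw [h0, h1] at hdet; simp at hdet
  have hnum : g 0 0 * x + g 0 1 ≠ 0 := by
    intro h0
    have : g 1 1 = -(g 1 0 * x) := by linarith
    rw [this] at hdet
    have : g 0 0 * (-(g 1 0 * x)) - g 0 1 * g 1 0 = -(g 1 0) * (g 0 0 * x + g 0 1) := by ring
    rw [this, h0] at hdet; simp at hdet
  -- the denominator is `g₁₀ (z - x)`
  have hden : ∀ z : ℂ, ((g 1 0 : ℝ) : ℂ) * z + (g 1 1 : ℝ) = (g 1 0 : ℝ) * (z - x) := by
    intro z
    have : ((g 1 1 : ℝ) : ℂ) = -((g 1 0 : ℝ) * (x : ℂ)) := by exact_mod_cast (by linarith : g 1 1 = -(g 1 0 * x))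
    rw [this]; ring
  -- norm of the Möbius map tends to infinity
  have hnorm : Tendsto (fun z ↦ ‖moebiusFun g z‖) (𝓝[upperHalfPlaneSet] (x : ℂ)) atTop := by
    have hEq : ∀ z, ‖moebiusFun g z‖ =
        ‖((g 0 0 : ℝ) : ℂ) * z + (g 0 1 : ℝ)‖ * ‖((g 1 0 : ℝ) : ℂ) * (z - x)‖⁻¹ := by
      intro z; rw [moebiusFun, hden, norm_div, div_eq_mul_inv]
    simp_rw [hEq]
    refine Tendsto.pos_mul_atTop (C := ‖((g 0 0 : ℝ) : ℂ) * x + (g 0 1 : ℝ)‖) ?_ ?_ ?_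
    · rw [norm_pos_iff]; exact_mod_cast hnum
    · exact ((by fun_prop : Continuous fun z : ℂ ↦ ‖((g 0 0 : ℝ) : ℂ) * z + (g 0 1 : ℝ)‖).tendsto
        (x : ℂ)).mono_left nhdsWithin_le_nhds
    · refine Tendsto.comp tendsto_inv_nhdsGT_zero ?_
      rw [tendsto_nhdsWithin_iff]
      refine ⟨?_, ?_⟩
      · have : Continuous fun z : ℂ ↦ ‖((g 1 0 : ℝ) : ℂ) * (z - x)‖ := by fun_prop
        simpa using (this.tendsto (x : ℂ)).mono_left nhdsWithin_le_nhds
      · refine eventually_mem_nhdsWithin.mono fun z hz => ?_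
        rw [mem_Ioi, norm_pos_iff, mul_ne_zero_iff, sub_ne_zero]
        refine ⟨by exact_mod_cast hc, ?_⟩
        rintro rfl
        simp [upperHalfPlaneSet] at hz
  have h1 : Tendsto (moebiusFun g) (𝓝[upperHalfPlaneSet] (x : ℂ))
      (cocompact ℂ ⊓ 𝓟 upperHalfPlaneSet) := by
    refine tendsto_inf.2 ⟨tendsto_cocompact_complex_of_norm_atTop hnorm, ?_⟩
    exact tendsto_principal.2 (eventually_mem_nhdsWithin.mono fun z hz => moebiusFun_mem g hz)
  have h2 : Tendsto (Φ ∘ moebiusFun g) (𝓝[upperHalfPlaneSet] (x : ℂ)) (𝓝 p) := hΦ.comp h1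
  refine h2.congr' ?_
  exact eventually_mem_nhdsWithin.mono fun z hz => (hφ z hz).symm

end Transfer


section Core

open ConformalEquiv

/-- Case analysis of the boundary values of the Schwarz–Christoffel map `Ψ` at a real point `m`,
as provided by `schwarzTriangleMap_isUniformizing`: there is a boundary value `p`; it is never the
apex `ζ`; and if it is real then `m ∈ [0, 1]` and `p = B(m; 1/3,1/3)/B(1/3,1/3)`. [folklore] -/
theorem schwarzTriangle_boundaryValue_cases {Ψ : ConformalEquiv upperHalfPlaneSet refEquilateralTriangle}
    (hΨ01 : ∀ u : ℝ, u ∈ Icc (0 : ℝ) 1 → Ψ.HasBoundaryValue u ((incBeta13 u / incBeta13 1 : ℝ) : ℂ))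
    (hΨneg : ∀ u : ℝ, u < 0 → ∃ p ∈ openSegment ℝ equilateralApex (0 : ℂ), Ψ.HasBoundaryValue u p)
    (hΨpos : ∀ u : ℝ, 1 < u → ∃ p ∈ openSegment ℝ (1 : ℂ) equilateralApex, Ψ.HasBoundaryValue u p)
    (m : ℝ) : ∃ p : ℂ, Ψ.HasBoundaryValue m p ∧
      (p.im = 0 → m ∈ Icc (0 : ℝ) 1 ∧ p = ((incBeta13 m / incBeta13 1 : ℝ) : ℂ)) ∧ p ≠ equilateralApex := by
  have h3 : (0 : ℝ) < Real.sqrt 3 / 2 := by positivity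
  rcases lt_or_ge m 0 with hm | hm
  · obtain ⟨p, ⟨t₁, t₂, ht₁, ht₂, hsum, rfl⟩, hbv⟩ := hΨneg m hm
    refine ⟨_, hbv, fun him => ?_, fun hpt => ?_⟩
    · exfalso
      have : (t₁ • equilateralApex + t₂ • (0 : ℂ)).im = t₁ * (Real.sqrt 3 / 2) := by simp
      rw [this] at him
      exact (mul_pos ht₁ h3).ne' him
    · have := congrArg Complex.im hpt
      simp at this
      have ht : t₁ = 1 := by
        have h' : (t₁ - 1) * (Real.sqrt 3 / 2) = 0 := by linarith
        rcases mul_eq_zero.1 h' with h'' | h''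
        · linarith
        · linarith
      linarith
  rcases le_or_gt m 1 with hm1 | hm1
  · refine ⟨_, hΨ01 m ⟨hm, hm1⟩, fun _ => ⟨⟨hm, hm1⟩, rfl⟩, (equilateralApex_ne_ofReal _).symm⟩
  · obtain ⟨p, ⟨t₁, t₂, ht₁, ht₂, hsum, rfl⟩, hbv⟩ := hΨpos m hm1
    refine ⟨_, hbv, fun him => ?_, fun hpt => ?_⟩
    · exfalso
      have : (t₁ • (1 : ℂ) + t₂ • equilateralApex).im = t₂ * (Real.sqrt 3 / 2) := by simp
      rw [this] at him
      exact (mul_pos ht₂ h3).ne' him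
    · have := congrArg Complex.im hpt
      simp at this
      have ht : t₂ = 1 := by
        have h' : (t₂ - 1) * (Real.sqrt 3 / 2) = 0 := by linarith
        rcases mul_eq_zero.1 h' with h'' | h''
        · linarith
        · linarith
      linarith

/-- **Core of Carleson's computation.** Let `V = L(T₀)` be a complex-affine image
(`L z = α z + β`) of the reference equilateral triangle and `φ : ℍₒ → V` a conformal equivalence
with boundary values `L 1, L ζ, L 0, L θ` (`θ` real) at the real points `x_A, x_B, x_C, x_D`. Then,
assuming `Aut(ℍ) = PSL(2,ℝ)` and the Schwarz–Christoffel uniformization, there is `e ∈ [0, 1]` with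
`B(e; 1/3,1/3)/B(1/3,1/3) = θ` and `(x_A - x_B)(x_C - x_D)/((x_A - x_C)(x_B - x_D)) = e`: the Möbius
map `g = (LΨ)⁻¹ ∘ φ` satisfies `g x_A = 1`, `g x_B = ∞`, `g x_C = 0`, `g x_D = e`
(Bollobás–Riordan 2006, Ch. 7 §1: "there is a unique Möbius transformation mapping `zᵢ` to `zᵢ'`";
"Möbius transformations preserve cross-ratios"). [cite: BollobasRiordan2006, Ch. 7 §1] -/
theorem carleson_crossRatio_core (h1 : conformalEquiv_upperHalfPlaneSet_eq_specialLinearGroup)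
    (h2 : schwarzTriangleMap_isUniformizing) {α β : ℂ} (hα : α ≠ 0) {V : Set ℂ}
    (hV : V = (fun z ↦ α * z + β) '' refEquilateralTriangle) (φ : ConformalEquiv upperHalfPlaneSet V)
    {xA xB xC xD : ℝ}
    (hA : φ.HasBoundaryValue xA (α + β)) (hB : φ.HasBoundaryValue xB (α * equilateralApex + β))
    (hC : φ.HasBoundaryValue xC β) {θ : ℝ} (hD : φ.HasBoundaryValue xD (α * θ + β)) :
    ∃ e ∈ Icc (0 : ℝ) 1, incBeta13 e / incBeta13 1 = θ ∧
      (xA - xB) * (xC - xD) / ((xA - xC) * (xB - xD)) = e := by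
  subst hV
  obtain ⟨Ψ, -, hΨ01, hΨneg, hΨpos, hΨinf⟩ := h2
  set Φ : ConformalEquiv upperHalfPlaneSet ((fun z ↦ α * z + β) '' refEquilateralTriangle) :=
    Ψ.trans (ConformalEquiv.affine α β hα refEquilateralTriangle) with hΦdef
  obtain ⟨g, hg⟩ := h1 (φ.trans Φ.symm)
  -- `φ = Φ ∘ g` on `ℍ`
  have hφ : ∀ z ∈ upperHalfPlaneSet, φ z = Φ (moebiusFun g z) := by
    intro z hz
    rw [← coe_smul_eq_moebiusFun g ⟨z, hz⟩, ← hg ⟨z, hz⟩]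
    change φ z = Φ (Φ.symm (φ z))
    rw [Φ.apply_symm_apply (φ.mapsTo hz)]
  have hcont : Continuous fun w : ℂ ↦ α * w + β := by fun_prop
  have hΦbv : ∀ (u : ℝ) (p : ℂ), Ψ.HasBoundaryValue u p → Φ.HasBoundaryValue u (α * p + β) :=
    fun u p h => (hcont.tendsto p).comp h
  have hΦinf : Φ.HasBoundaryValueAtInfty (α * equilateralApex + β) := (hcont.tendsto equilateralApex).comp hΨinf
  -- boundary values of `φ` at poles and at regular points of `g`
  have hpole : ∀ x : ℝ, g 1 0 * x + g 1 1 = 0 → ∀ q : ℂ, φ.HasBoundaryValue x q →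
      q = α * equilateralApex + β := fun x hx q hq =>
    hq.unique (hasBoundaryValue_of_moebius_pole hφ hx hΦinf)
  have hfin : ∀ x : ℝ, g 1 0 * x + g 1 1 ≠ 0 → ∀ q : ℂ, φ.HasBoundaryValue x q →
      ∃ p : ℂ, (p.im = 0 → (g 0 0 * x + g 0 1) / (g 1 0 * x + g 1 1) ∈ Icc (0 : ℝ) 1 ∧
        p = ((incBeta13 ((g 0 0 * x + g 0 1) / (g 1 0 * x + g 1 1)) / incBeta13 1 : ℝ) : ℂ)) ∧
        p ≠ equilateralApex ∧ q = α * p + β := by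
    intro x hx q hq
    obtain ⟨p, hbv, hcl, hne⟩ := schwarzTriangle_boundaryValue_cases hΨ01 hΨneg hΨpos
      ((g 0 0 * x + g 0 1) / (g 1 0 * x + g 1 1))
    exact ⟨p, hcl, hne, hq.unique (hasBoundaryValue_of_moebius hφ hx (hΦbv _ _ hbv))⟩
  have hI1 : incBeta13 1 ≠ 0 := incBeta13_one_pos.ne'
  -- the point `B` is a pole
  have hBpole : g 1 0 * xB + g 1 1 = 0 := by
    by_contra hx
    obtain ⟨p, -, hne, hq⟩ := hfin xB hx _ hB
    exact hne (mul_left_cancel₀ hα (add_right_cancel hq)).symm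
  -- the point `A` goes to `1`
  have hAfin : g 1 0 * xA + g 1 1 ≠ 0 := by
    intro hx
    have := hpole xA hx _ hA
    have : α * 1 + β = α * equilateralApex + β := by simpa using this
    exact equilateralApex_ne_one (mul_left_cancel₀ hα (add_right_cancel this)).symm
  have hAval : (g 0 0 * xA + g 0 1) / (g 1 0 * xA + g 1 1) = 1 := by
    obtain ⟨p, hcl, -, hq⟩ := hfin xA hAfin _ hA
    have hp : p = 1 := by
      have : α * 1 + β = α * p + β := by simpa using hq
      exact (mul_left_cancel₀ hα (add_right_cancel this)).symm
    subst hp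
    obtain ⟨hmem, hval⟩ := hcl (by simp)
    have hval' : incBeta13 ((g 0 0 * xA + g 0 1) / (g 1 0 * xA + g 1 1)) / incBeta13 1 = 1 := by
      exact_mod_cast hval.symm
    rw [div_eq_one_iff_eq hI1] at hval'
    exact injOn_incBeta13 hmem ⟨zero_le_one, le_rfl⟩ hval'
  -- the point `C` goes to `0`
  have hCfin : g 1 0 * xC + g 1 1 ≠ 0 := by
    intro hx
    have := hpole xC hx _ hC
    have : α * 0 + β = α * equilateralApex + β := by simpa using this
    exact equilateralApex_ne_zero (mul_left_cancel₀ hα (add_right_cancel this)).symm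
  have hCval : (g 0 0 * xC + g 0 1) / (g 1 0 * xC + g 1 1) = 0 := by
    obtain ⟨p, hcl, -, hq⟩ := hfin xC hCfin _ hC
    have hp : p = 0 := by
      have : α * 0 + β = α * p + β := by simpa using hq
      exact (mul_left_cancel₀ hα (add_right_cancel this)).symm
    subst hp
    obtain ⟨hmem, hval⟩ := hcl (by simp)
    have hval' : incBeta13 ((g 0 0 * xC + g 0 1) / (g 1 0 * xC + g 1 1)) / incBeta13 1 = 0 := by
      exact_mod_cast hval.symm
    rw [div_eq_zero_iff, or_iff_left hI1, ← incBeta13_zero] at hval'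
    exact injOn_incBeta13 hmem ⟨le_rfl, zero_le_one⟩ hval'
  -- the point `D` goes to some `e ∈ [0, 1]`
  have hDfin : g 1 0 * xD + g 1 1 ≠ 0 := by
    intro hx
    have := hpole xD hx _ hD
    exact equilateralApex_ne_ofReal θ (mul_left_cancel₀ hα (add_right_cancel this)).symm
  obtain ⟨hDmem, hDval⟩ : (g 0 0 * xD + g 0 1) / (g 1 0 * xD + g 1 1) ∈ Icc (0 : ℝ) 1 ∧
      incBeta13 ((g 0 0 * xD + g 0 1) / (g 1 0 * xD + g 1 1)) / incBeta13 1 = θ := by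
    obtain ⟨p, hcl, -, hq⟩ := hfin xD hDfin _ hD
    have hp : p = θ := (mul_left_cancel₀ hα (add_right_cancel hq)).symm
    subst hp
    obtain ⟨hmem, hval⟩ := hcl (by simp)
    exact ⟨hmem, by exact_mod_cast hval.symm⟩
  refine ⟨_, hDmem, hDval, ?_⟩
  -- the cross-ratio computation
  have hdet := sl2_det_entries g
  set a := g 0 0
  set b := g 0 1
  set c := g 1 0
  set d := g 1 1
  have hc : c ≠ 0 := by
    intro h0
    have h1 : d = 0 := by simpa [h0] using hBpole
    rw [h0, h1] at hdet; simp at hdet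
  have hxB : xB = -d / c := by field_simp; linarith
  have hA' : a * xA + b = c * xA + d := (div_eq_one_iff_eq hAfin).1 hAval
  have hC' : a * xC + b = 0 := by
    rwa [div_eq_zero_iff, or_iff_left hCfin] at hCval
  have ha : a ≠ 0 := by
    intro h0
    have h1 : b = 0 := by simpa [h0] using hC'
    rw [h0, h1] at hdet; simp at hdet
  have hac : a - c ≠ 0 := by
    intro h0
    have h0' : a = c := by linarith
    have h1 : b = d := by rw [h0'] at hA'; linarith
    rw [h0', h1] at hdet
    have : c * d - d * c = 0 := by ring
    rw [this] at hdet; simp at hdet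
  have hxC : xC = -b / a := by field_simp; linarith
  have hxA : xA = (d - b) / (a - c) := by field_simp; linarith
  rw [hxA, hxB, hxC]
  have e1 : (d - b) / (a - c) - -d / c = 1 / (c * (a - c)) := by
    field_simp
    linear_combination hdet
  have e2 : -b / a - xD = -(a * xD + b) / a := by field_simp; ring
  have e3 : (d - b) / (a - c) - -b / a = 1 / (a * (a - c)) := by
    field_simp
    linear_combination hdet
  have e4 : -d / c - xD = -(c * xD + d) / c := by field_simp; ring
  rw [e1, e2, e3, e4]
  field_simp

end Core


section Assembly

/-- The two orientations of a non-degenerate equilateral triangle `abc`: `b = c + (a - c) ζ` or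
`b = a + (c - a) ζ` with `ζ = e^{iπ/3}` (elementary: `u = (b - c)/(a - c)` has `|u| = |u - 1| = 1`). [folklore] -/
theorem equilateral_apex_cases {a b c : ℂ} (h1 : dist a b = dist b c) (h2 : dist b c = dist c a)
    (hab : a ≠ b) : a ≠ c ∧ (b = (a - c) * equilateralApex + c ∨ b = (c - a) * equilateralApex + a) := by
  have hac : a ≠ c := by
    rintro rfl
    rw [dist_self, dist_eq_zero] at h2
    exact hab h2.symm
  refine ⟨hac, ?_⟩
  have hac' : a - c ≠ 0 := sub_ne_zero.2 hac
  set u : ℂ := (b - c) / (a - c) with hu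
  have hbu : b = (a - c) * u + c := by rw [hu]; field_simp; ring
  have hn1 : ‖u‖ = 1 := by
    rw [hu, norm_div, ← dist_eq_norm, ← dist_eq_norm, dist_comm a c, h2, div_self]
    exact dist_ne_zero.2 (Ne.symm hac)
  have hn2 : ‖u - 1‖ = 1 := by
    have : u - 1 = (b - a) / (a - c) := by rw [hu]; field_simp; ring
    rw [this, norm_div, ← dist_eq_norm, ← dist_eq_norm, dist_comm b a, h1, h2, dist_comm c a,
      div_self]
    exact dist_ne_zero.2 hac
  have e1 : u.re * u.re + u.im * u.im = 1 := by
    rw [← Complex.normSq_apply, ← Complex.sq_norm, hn1, one_pow]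
  have e2 : (u.re - 1) * (u.re - 1) + u.im * u.im = 1 := by
    have := Complex.normSq_apply (u - 1)
    rw [← Complex.sq_norm, hn2, one_pow] at this
    simpa using this.symm
  have hre : u.re = 1 / 2 := by nlinarith
  have him : u.im ^ 2 = (Real.sqrt 3 / 2) ^ 2 := by
    rw [div_pow, Real.sq_sqrt (by norm_num : (0 : ℝ) ≤ 3)]
    nlinarith
  rcases sq_eq_sq_iff_eq_or_eq_neg.1 him with hi | hi
  · left
    have : u = equilateralApex := Complex.ext (by simp [hre]) (by simp [hi])
    rw [hbu, this]
  · right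
    have : u = 1 - equilateralApex := Complex.ext (by simp [hre]; norm_num) (by simp [hi])
    rw [hbu, this]
    ring

/-- The complementary cross-ratio: exchanging `x₀ ↔ x₂` replaces `η` by `1 - η`
(Bollobás–Riordan 2006, Ch. 7 §1, `η(D₄*) = 1 - η(D₄)`). [cite: BollobasRiordan2006, Ch. 7 §1] -/
theorem crossRatio_swap02 (x : Fin 4 → ℝ) (h02 : x 0 ≠ x 2) (h13 : x 1 ≠ x 3) :
    crossRatio x = 1 - (x 2 - x 1) * (x 0 - x 3) / ((x 2 - x 0) * (x 1 - x 3)) := by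
  unfold crossRatio
  have h1 : x 0 - x 2 ≠ 0 := sub_ne_zero.2 h02
  have h2 : x 2 - x 0 ≠ 0 := sub_ne_zero.2 (Ne.symm h02)
  have h3 : x 1 - x 3 ≠ 0 := sub_ne_zero.2 h13
  field_simp
  ring

/-- **Carleson's form of Cardy's formula** (`Literature.Probability.RandomPlanarGeometry.cardyFunction_crossRatio_eq_of_equilateral`,
Bollobás–Riordan 2006, Ch. 7, eq. (3); Werner 2007, Conj. 2.1; Smirnov 2001, Cor. 3) **reduced to
three classical analytic facts**: `Aut(ℍ) = PSL(2, ℝ)`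
(`conformalEquiv_upperHalfPlaneSet_eq_specialLinearGroup`), the Schwarz–Christoffel uniformization
of the equilateral triangle (`schwarzTriangleMap_isUniformizing`), and the identification of Cardy's
function with the regularised incomplete beta function (`cardyFunction_eq_incBeta13_div`). The two
orientations of `abc` are treated by `L z = c + (a - c) z` (real points in the order `1, ∞, 0, e`)
and `L z = a + (c - a) z` (order `0, ∞, 1, e`, cross-ratio `1 - e`, using `B(1-e) = B(1) - B(e)`). [cite: BollobasRiordan2006, Ch. 7 eq. (3)] -/
theorem cardyFunction_crossRatio_eq_of_equilateral_of_facts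
    (h1 : conformalEquiv_upperHalfPlaneSet_eq_specialLinearGroup)
    (h2 : schwarzTriangleMap_isUniformizing) (h3 : cardyFunction_eq_incBeta13_div) :
    RandomPlanarGeometry.cardyFunction_crossRatio_eq_of_equilateral := by
  intro R a b c d habc hR hpt hd hdc hda φ x hφ
  obtain ⟨hab_bc, hbc_ca, hab⟩ := habc
  obtain ⟨hac, hcase⟩ := equilateral_apex_cases hab_bc hbc_ca hab
  rw [segment_eq_image'] at hd
  obtain ⟨θ, hθ, rfl⟩ := hd
  dsimp only at hpt hdc hda ⊢
  have hac' : a - c ≠ 0 := sub_ne_zero.2 hac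
  have hnorm : ‖c + θ • (a - c) - c‖ / ‖a - c‖ = θ := by
    rw [add_sub_cancel_left, norm_smul, Real.norm_of_nonneg hθ.1, mul_div_assoc,
      div_self (norm_ne_zero_iff.2 hac'), mul_one]
  rw [hnorm]
  have hbv := hφ.2
  have hinj := hφ.injective
  have hsmul : (θ • (a - c) : ℂ) = (θ : ℂ) * (a - c) := by rw [Complex.real_smul]
  rcases hcase with hb | hb
  · -- positively oriented: `L z = (a - c) z + c` sends `1, ζ, 0` to `a, b, c`
    have hV : R.carrier = (fun z ↦ (a - c) * z + c) '' refEquilateralTriangle := by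
      rw [hR, image_affine_refEquilateralTriangle _ _ hac', ← hb, sub_add_cancel]
    have hA : φ.HasBoundaryValue (x 0) ((a - c) + c) := by
      have := hbv 0
      rw [hpt.1] at this
      simpa using this
    have hB : φ.HasBoundaryValue (x 1) ((a - c) * equilateralApex + c) := by
      have := hbv 1; rwa [hpt.2.1, hb] at this
    have hC : φ.HasBoundaryValue (x 2) c := by
      have := hbv 2; rwa [hpt.2.2.1] at this
    have hD : φ.HasBoundaryValue (x 3) ((a - c) * θ + c) := by
      have h := hbv 3
      have e : c + θ • (a - c) = (a - c) * (θ : ℂ) + c := by rw [hsmul]; ring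
      rwa [hpt.2.2.2, e] at h
    obtain ⟨e, he, heθ, hcr⟩ := RandomPlanarGeometry.carleson_crossRatio_core h1 h2 hac' hV φ hA hB hC hD
    rw [crossRatio, hcr, h3 e he, heθ]
  · -- negatively oriented: `L z = (c - a) z + a` sends `1, ζ, 0` to `c, b, a`
    have hca' : c - a ≠ 0 := sub_ne_zero.2 (Ne.symm hac)
    have hset : ({a, b, c} : Set ℂ) = {c, b, a} := by
      ext z
      simp only [mem_insert_iff, mem_singleton_iff]
      tauto
    have hV : R.carrier = (fun z ↦ (c - a) * z + a) '' refEquilateralTriangle := by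
      rw [hR, hset, image_affine_refEquilateralTriangle _ _ hca', ← hb, sub_add_cancel]
    have hθ' : 1 - θ ∈ Icc (0 : ℝ) 1 := ⟨by linarith [hθ.2], by linarith [hθ.1]⟩
    have hA : φ.HasBoundaryValue (x 2) ((c - a) + a) := by
      have := hbv 2
      rw [hpt.2.2.1] at this
      simpa using this
    have hB : φ.HasBoundaryValue (x 1) ((c - a) * equilateralApex + a) := by
      have := hbv 1; rwa [hpt.2.1, hb] at this
    have hC : φ.HasBoundaryValue (x 0) a := by
      have := hbv 0; rwa [hpt.1] at this
    have hD : φ.HasBoundaryValue (x 3) ((c - a) * (1 - θ : ℝ) + a) := by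
      have h := hbv 3
      have e : c + θ • (a - c) = (c - a) * ((1 - θ : ℝ) : ℂ) + a := by
        rw [hsmul]; push_cast; ring
      rwa [hpt.2.2.2, e] at h
    obtain ⟨e, he, heθ, hcr⟩ := RandomPlanarGeometry.carleson_crossRatio_core h1 h2 hca' hV φ hA hB hC hD
    have h02 : x 0 ≠ x 2 := fun h => by simpa using hinj h
    have h13 : x 1 ≠ x 3 := fun h => by simpa using hinj h
    have he' : 1 - e ∈ Icc (0 : ℝ) 1 := ⟨by linarith [he.2], by linarith [he.1]⟩
    rw [crossRatio_swap02 x h02 h13, hcr, h3 (1 - e) he', incBeta13_one_sub he, sub_div,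
      div_self incBeta13_one_pos.ne', heθ]
    ring

end Assembly

end Literature.Probability.RandomPlanarGeometry
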